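import Mathlib
import Literature.NumberTheory.LFunctions.Zhang2022.Section12SjWindowEngine
import Literature.NumberTheory.LFunctions.Zhang2022.Section12SjWindowMajorant
import Literature.NumberTheory.LFunctions.Zhang2022.Section12SjWindowWeights
import HarnessLib

/-!
# Zhang (2022) §§7, 11, 12: the sharp absolute-value bound for `S_j(𝐚₁,𝐚₂)` on window-supported
# sequences — `|S_j| ≤ B₁B₂·E·(δ(δ' log 2Y' + log(2/δ)) + 1/√(δY))`

Topic `Literature/NumberTheory/LFunctions/Zhang2022` (Landau–Siegel audit tree; verdict-neutral).
Y. Zhang, *Discrete mean estimates and the Landau–Siegel zero*, arXiv:2211.02515v1 (2022)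
[Zhang2022LandauSiegel], §7 Prop. 7.1 p. 33 (`S_j(𝐚₁,𝐚₂)`), §11 p. 64 and §12 p. 67
("… by (8.25), (8.26) and simple estimates"; (8.25)/(8.26) do not exist in v1) — **an unrefereed
manuscript under adjudication; nothing here asserts or denies its Theorems 1–2** (ZHANG-L
discharge lane, WP11/WP12).

`norm_Sj_window_le`: if `|a₁| ≤ B₁` on the window `(Y, Y(1+δ)]` and `a₁ = 0` off it, `|a₂| ≤ B₂`
on `(Y', Y'(1+δ')]` and `0` off it (`1 ≤ Y, Y'`, `0 < δ, δ' ≤ 1`), then for `D ≥ ⌈exp(5|c′|π+3)⌉`,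
`log D ≥ 2` and every `j`,
`‖S_j(𝐚₁,𝐚₂)‖ ≤ B₁B₂·E_w·(2δ(δ'(1 + log 2Y') + 2) + 4δ(1 + log(2/δ)) + 16/√(δY))`,
`E_w = 2E_S·e^{112}(e^{12+6S₀} + e^{48})` absolute. Assembly of
`SjWindowEngine.window_triple_sum_le` (counting), `XiZeroMajorant.norm_xiZero_le_two_pow_mul_GS`
+ `GS_means_ell` (the `G`-input) and `sum_LamC_short_le` + `sum_rho_div_sqrt_le` (the `c`-input),
after `|S_j| ≤ Σ_{d,r} Λc(d)Λc(r)2^{ω(r)}/(drφ(r))·(B₁Σ_{m:drm∈W}1/m)(B₂Σ_{n:drn∈W'}GS(n)/n)` and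
the regrouping `k = dr`. For the `𝓛⁻¹⁰`-windows of §§11–12 (`δ ≍ 𝓛⁻¹⁰`, `Y ≤ 2P`) the right
side is `B₁B₂·O(𝓛⁻¹⁰ log 𝓛)`. No statement about the manuscript's Theorems 1–2 or about
Landau–Siegel zeros is made or implied.

## References

* Y. Zhang, arXiv:2211.02515v1 (2022), §7 Prop. 7.1 p. 33; §11 p. 64; §12 p. 67.
  [cite: Zhang2022LandauSiegel, §7 Prop. 7.1 p.33; §11 p.64; §12 p.67]
-/

noncomputable section

open Finset Real ArithmeticFunction

namespace Literature.NumberTheory.LFunctions.Zhang2022.XiZeroMajorant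

open SjWindowEngine

/-! ### Part 1. One term of `S_j`, keeping `1/φ(r)` and the window structure -/

/-- **One term of `S_j` for window-supported sequences.** For `d, r ≥ 1`, `N ≥ 1` and sequences
with `‖a₁ n‖ ≤ B₁·[Y < n ≤ Y(1+δ)]`, `‖a₂ n‖ ≤ B₂·[Y' < n ≤ Y'(1+δ')]`:
`‖|μ(r)|λ₀ⱼ(dr)/(drφ(r))·(Σ_{m<N} a₁(drm)m^{−(1−β_j)})·(Σ_{n<N} a₂(drn)ξ₀ⱼ(n;d,r)/n)‖`
`≤ B₁B₂·(Λc(d)·Λc(r)2^{ω(r)}/φ(r))/(dr)·(Σ_{m<N,drm∈W} 1/m)·(Σ_{n<N,drn∈W'} GS(n)/n)`.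
[cite: Zhang2022LandauSiegel, §7 Prop. 7.1 p.33] -/
theorem norm_Sj_term_window_le (c' : ℝ) (D : ℕ) {d r : ℕ} (hd : d ≠ 0) (hr : r ≠ 0) (j N : ℕ)
    {a₁ a₂ : ℕ → ℂ} {B₁ B₂ Y Y' δ δ' : ℝ} (hB₁ : 0 ≤ B₁) (hB₂ : 0 ≤ B₂)
    (ha₁ : ∀ n : ℕ, ‖a₁ n‖ ≤ if Y < (n : ℝ) ∧ (n : ℝ) ≤ Y * (1 + δ) then B₁ else 0)
    (ha₂ : ∀ n : ℕ, ‖a₂ n‖ ≤ if Y' < (n : ℝ) ∧ (n : ℝ) ≤ Y' * (1 + δ') then B₂ else 0) :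
    ‖((ArithmeticFunction.moebius r).natAbs : ℂ) * Skeleton.lamZero c' D j (d * r) /
          ((d * r : ℕ) * (Nat.totient r : ℂ)) *
        (∑ m ∈ Ico 1 N, a₁ (d * r * m) / (m : ℂ) ^ (1 - Skeleton.betaJ c' D j)) *
        (∑ n ∈ Ico 1 N, a₂ (d * r * n) * Skeleton.xiZero c' D j n d r / (n : ℂ))‖ ≤
      B₁ * B₂ * ((LamC d * (LamC r * (2 : ℝ) ^ r.primeFactors.card / (Nat.totient r : ℝ))) /
          ((d * r : ℕ) : ℝ)) *
        (∑ m ∈ Ico 1 N, if Y < ((d * r : ℕ) : ℝ) * m ∧ ((d * r : ℕ) : ℝ) * m ≤ Y * (1 + δ)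
            then (1 : ℝ) / m else 0) *
        (∑ n ∈ Ico 1 N, if Y' < ((d * r : ℕ) : ℝ) * n ∧ ((d * r : ℕ) : ℝ) * n ≤ Y' * (1 + δ')
            then GS c' D n / n else 0) := by
  have hdr : d * r ≠ 0 := mul_ne_zero hd hr
  have hdrpos : (0 : ℝ) < ((d * r : ℕ) : ℝ) := by exact_mod_cast Nat.pos_of_ne_zero hdr
  have hφpos : (0 : ℝ) < Nat.totient r := by exact_mod_cast Nat.totient_pos.mpr (Nat.pos_of_ne_zero hr)
  -- the weight
  have hw : ‖((ArithmeticFunction.moebius r).natAbs : ℂ) * Skeleton.lamZero c' D j (d * r) /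
      ((d * r : ℕ) * (Nat.totient r : ℂ))‖ ≤
      (LamC d * (LamC r * (2 : ℝ) ^ r.primeFactors.card / (Nat.totient r : ℝ))) / ((d * r : ℕ) : ℝ) /
        (2 : ℝ) ^ r.primeFactors.card := by
    rw [norm_div, norm_mul, norm_mul, Complex.norm_natCast, Complex.norm_natCast,
      Complex.norm_natCast]
    have hlam : ‖Skeleton.lamZero c' D j (d * r)‖ ≤ LamC d * LamC r :=
      (norm_lamZero_le_LamC c' D hdr j).trans (LamC_mul_le hd hr)
    have hμ := natAbs_moebius_le_one r
    have h2 : (0 : ℝ) < (2 : ℝ) ^ r.primeFactors.card := by positivity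
    have e : (LamC d * (LamC r * (2 : ℝ) ^ r.primeFactors.card / (Nat.totient r : ℝ))) /
        ((d * r : ℕ) : ℝ) / (2 : ℝ) ^ r.primeFactors.card =
        LamC d * LamC r / (((d * r : ℕ) : ℝ) * Nat.totient r) := by
      field_simp
    rw [e, div_le_div_iff₀ (by positivity) (by positivity)]
    calc ((ArithmeticFunction.moebius r).natAbs : ℝ) * ‖Skeleton.lamZero c' D j (d * r)‖ *
          (((d * r : ℕ) : ℝ) * Nat.totient r)
        ≤ 1 * (LamC d * LamC r) * (((d * r : ℕ) : ℝ) * Nat.totient r) :=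
          mul_le_mul_of_nonneg_right (mul_le_mul hμ hlam (norm_nonneg _) zero_le_one)
            (by positivity)
      _ = LamC d * LamC r * (((d * r : ℕ) : ℝ) * (Nat.totient r : ℝ)) := by ring
  -- the `m`-sum
  have hm : ‖∑ m ∈ Ico 1 N, a₁ (d * r * m) / (m : ℂ) ^ (1 - Skeleton.betaJ c' D j)‖ ≤
      B₁ * ∑ m ∈ Ico 1 N, (if Y < ((d * r : ℕ) : ℝ) * m ∧ ((d * r : ℕ) : ℝ) * m ≤ Y * (1 + δ)
        then (1 : ℝ) / m else 0) := by
    rw [mul_sum]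
    refine (norm_sum_le _ _).trans (sum_le_sum fun m hm => ?_)
    have hmpos : 0 < m := (mem_Ico.mp hm).1
    have hm0 : (0 : ℝ) < m := by exact_mod_cast hmpos
    rw [norm_div, Complex.norm_natCast_cpow_of_pos hmpos, one_sub_betaJ_re, Real.rpow_one]
    have h := ha₁ (d * r * m)
    push_cast at h ⊢
    split_ifs at h with hc
    · rw [if_pos hc]
      rw [div_le_iff₀ hm0]
      calc ‖a₁ (d * r * m)‖ ≤ B₁ := h
        _ = B₁ * (1 / (m : ℝ)) * m := by field_simp
    · rw [if_neg hc, mul_zero]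
      have : ‖a₁ (d * r * m)‖ = 0 := le_antisymm h (norm_nonneg _)
      rw [this, zero_div]
  -- the `n`-sum
  have hn : ‖∑ n ∈ Ico 1 N, a₂ (d * r * n) * Skeleton.xiZero c' D j n d r / (n : ℂ)‖ ≤
      B₂ * (2 : ℝ) ^ r.primeFactors.card *
        ∑ n ∈ Ico 1 N, (if Y' < ((d * r : ℕ) : ℝ) * n ∧ ((d * r : ℕ) : ℝ) * n ≤ Y' * (1 + δ')
          then GS c' D n / n else 0) := by
    rw [mul_sum]
    refine (norm_sum_le _ _).trans (sum_le_sum fun n hn => ?_)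
    have hnpos : 0 < n := (mem_Ico.mp hn).1
    have hn0 : (0 : ℝ) < n := by exact_mod_cast hnpos
    rw [norm_div, norm_mul, Complex.norm_natCast]
    have h := ha₂ (d * r * n)
    have hξ := norm_xiZero_le_two_pow_mul_GS c' D j hd hr (Nat.pos_iff_ne_zero.mp hnpos)
    push_cast at h ⊢
    split_ifs at h with hc
    · rw [if_pos hc, div_le_iff₀ hn0]
      calc ‖a₂ (d * r * n)‖ * ‖Skeleton.xiZero c' D j n d r‖
          ≤ B₂ * ((2 : ℝ) ^ r.primeFactors.card * GS c' D n) :=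
            mul_le_mul h hξ (norm_nonneg _) hB₂
        _ = B₂ * (2 : ℝ) ^ r.primeFactors.card * (GS c' D n / n) * n := by field_simp
    · rw [if_neg hc, mul_zero]
      have : ‖a₂ (d * r * n)‖ = 0 := le_antisymm h (norm_nonneg _)
      rw [this, zero_mul, zero_div]
  -- assemble
  have hM0 : 0 ≤ ∑ m ∈ Ico 1 N, (if Y < ((d * r : ℕ) : ℝ) * m ∧ ((d * r : ℕ) : ℝ) * m ≤ Y * (1 + δ)
      then (1 : ℝ) / m else 0) := sum_nonneg fun m _ => by
    split_ifs <;> [exact div_nonneg zero_le_one (Nat.cast_nonneg m); exact le_rfl]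
  have hN0 : 0 ≤ ∑ n ∈ Ico 1 N, (if Y' < ((d * r : ℕ) : ℝ) * n ∧ ((d * r : ℕ) : ℝ) * n ≤ Y' * (1 + δ')
      then GS c' D n / n else 0) := sum_nonneg fun n _ => by
    split_ifs <;> [exact div_nonneg (GS_nonneg c' D n) (Nat.cast_nonneg n); exact le_rfl]
  have hρ0 : 0 ≤ LamC d * (LamC r * (2 : ℝ) ^ r.primeFactors.card / (Nat.totient r : ℝ)) :=
    mul_nonneg (LamC_nonneg d) (div_nonneg (mul_nonneg (LamC_nonneg r) (by positivity)) hφpos.le)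
  have hw0 : 0 ≤ (LamC d * (LamC r * (2 : ℝ) ^ r.primeFactors.card / (Nat.totient r : ℝ))) /
      ((d * r : ℕ) : ℝ) / (2 : ℝ) ^ r.primeFactors.card := by positivity
  rw [norm_mul, norm_mul]
  calc _ ≤ ((LamC d * (LamC r * (2 : ℝ) ^ r.primeFactors.card / (Nat.totient r : ℝ))) /
          ((d * r : ℕ) : ℝ) / (2 : ℝ) ^ r.primeFactors.card) *
        (B₁ * ∑ m ∈ Ico 1 N, (if Y < ((d * r : ℕ) : ℝ) * m ∧ ((d * r : ℕ) : ℝ) * m ≤ Y * (1 + δ)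
          then (1 : ℝ) / m else 0)) *
        (B₂ * (2 : ℝ) ^ r.primeFactors.card *
          ∑ n ∈ Ico 1 N, (if Y' < ((d * r : ℕ) : ℝ) * n ∧ ((d * r : ℕ) : ℝ) * n ≤ Y' * (1 + δ')
            then GS c' D n / n else 0)) :=
        mul_le_mul (mul_le_mul hw hm (norm_nonneg _) hw0) hn (norm_nonneg _)
          (mul_nonneg hw0 (mul_nonneg hB₁ hM0))
    _ = _ := by
        have h2 : (2 : ℝ) ^ r.primeFactors.card ≠ 0 := by positivity
        field_simp


/-! ### Part 2. The `c`-input: short sums of `c̃(k) = Σ_{dr=k} Λc(d)·Λc(r)2^{ω(r)}/φ(r)` -/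

/-- The absolute constant `A' = e^{112}(e^{12+6S₀} + e^{48})` of the short sums of `c̃`.
[cite: Zhang2022LandauSiegel, §7 Prop. 7.1 p.33] -/
def Aw : ℝ := Real.exp 112 * (Real.exp (12 + 6 * LogEulerProduct.tailConst 0) + Real.exp 48)

/-- `0 ≤ A'`. [cite: Zhang2022LandauSiegel, §7 Prop. 7.1 p.33] -/
theorem Aw_nonneg : 0 ≤ Aw := by unfold Aw; positivity

/-- **Short sums of the regrouped weight.** For every `Nm, K'` and reals `y, h ≥ 0`:
`Σ_{y<k≤y+h, k≤K'} Σ_{(d,r)∈[1,Nm]², dr=k} Λc(d)Λc(r)2^{ω(r)}/φ(r) ≤ A'(h + √(y+h))`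
(for each `r` the `d` run over `(y/r, (y+h)/r]`: `sum_LamC_short_le`; then `sum_rho_div_le`,
`sum_rho_div_sqrt_le`). [cite: Zhang2022LandauSiegel, §7 Prop. 7.1 p.33; §12 p.67] -/
theorem sum_cTilde_short_le (Nm K' : ℕ) {y h : ℝ} (hy : 0 ≤ y) (hh : 0 ≤ h) :
    ∑ k ∈ (Icc 1 K').filter (fun k : ℕ => y < (k : ℝ) ∧ (k : ℝ) ≤ y + h),
      ∑ x ∈ (Icc 1 Nm ×ˢ Icc 1 Nm).filter (fun x : ℕ × ℕ => x.1 * x.2 = k),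
        LamC x.1 * (LamC x.2 * (2 : ℝ) ^ x.2.primeFactors.card / (Nat.totient x.2 : ℝ)) ≤
      Aw * (h + Real.sqrt (y + h)) := by
  set pairs := Icc 1 Nm ×ˢ Icc 1 Nm with hpairs
  set T := (Icc 1 K').filter (fun k : ℕ => y < (k : ℝ) ∧ (k : ℝ) ≤ y + h) with hT
  set wt : ℕ × ℕ → ℝ := fun x =>
    LamC x.1 * (LamC x.2 * (2 : ℝ) ^ x.2.primeFactors.card / (Nat.totient x.2 : ℝ)) with hwt
  set ρ : ℕ → ℝ := fun r => LamC r * (2 : ℝ) ^ r.primeFactors.card / (Nat.totient r : ℝ) with hρ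
  have hwt0 : ∀ x, 0 ≤ wt x := fun x =>
    mul_nonneg (LamC_nonneg _) (div_nonneg (mul_nonneg (LamC_nonneg _) (by positivity))
      (Nat.cast_nonneg _))
  have hρ0 : ∀ r, 0 ≤ ρ r := fun r =>
    div_nonneg (mul_nonneg (LamC_nonneg _) (by positivity)) (Nat.cast_nonneg _)
  set E₀ := Real.exp (12 + 6 * LogEulerProduct.tailConst 0) with hE₀
  set E₁ := Real.exp 48 with hE₁
  -- Step 1: un-fiber and enlarge the filter
  have hstep1 : ∑ k ∈ T, ∑ x ∈ pairs.filter (fun x : ℕ × ℕ => x.1 * x.2 = k), wt x ≤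
      ∑ x ∈ pairs.filter (fun x : ℕ × ℕ => y < ((x.1 * x.2 : ℕ) : ℝ) ∧ ((x.1 * x.2 : ℕ) : ℝ) ≤ y + h),
        wt x := by
    rw [sum_fiberwise_eq_sum_filter pairs T (fun x : ℕ × ℕ => x.1 * x.2) wt]
    refine sum_le_sum_of_subset_of_nonneg (fun x hx => ?_) fun x _ _ => hwt0 x
    rw [mem_filter] at hx ⊢
    rw [hT, mem_filter] at hx
    exact ⟨hx.1, hx.2.2⟩
  -- Step 2: write the pair sum as `Σ_r ρ(r) Σ_{d : y/r < d ≤ (y+h)/r} Λc(d)`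
  have hstep2 : ∑ x ∈ pairs.filter
        (fun x : ℕ × ℕ => y < ((x.1 * x.2 : ℕ) : ℝ) ∧ ((x.1 * x.2 : ℕ) : ℝ) ≤ y + h), wt x =
      ∑ r ∈ Icc 1 Nm, ρ r * ∑ d ∈ (Icc 1 Nm).filter
        (fun d : ℕ => y / r < (d : ℝ) ∧ (d : ℝ) ≤ y / r + h / r), LamC d := by
    rw [sum_filter, hpairs, sum_product, sum_comm]
    refine sum_congr rfl fun r hr => ?_
    have hr0 : (0 : ℝ) < r := by exact_mod_cast (mem_Icc.mp hr).1
    rw [sum_filter, mul_sum]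
    refine sum_congr rfl fun d _ => ?_
    have e : (y < ((d * r : ℕ) : ℝ) ∧ ((d * r : ℕ) : ℝ) ≤ y + h) ↔
        (y / r < (d : ℝ) ∧ (d : ℝ) ≤ y / r + h / r) := by
      push_cast
      rw [div_lt_iff₀ hr0, ← add_div, le_div_iff₀ hr0]
    simp only [e, hwt, hρ]
    split_ifs <;> ring
  -- Step 3: short sums of `Λc` and the `ρ`-weights
  have hstep3 : ∀ r ∈ Icc 1 Nm, ρ r * ∑ d ∈ (Icc 1 Nm).filter
      (fun d : ℕ => y / r < (d : ℝ) ∧ (d : ℝ) ≤ y / r + h / r), LamC d ≤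
      E₀ * h * (ρ r / r) + E₁ * Real.sqrt (y + h) * (ρ r / Real.sqrt r) := by
    intro r hr
    have hr0 : (0 : ℝ) < r := by exact_mod_cast (mem_Icc.mp hr).1
    have hb := sum_LamC_short_le Nm (u := y / r) (v := h / r) (by positivity) (by positivity)
    have hsq : Real.sqrt (y / r + h / r) = Real.sqrt (y + h) / Real.sqrt r := by
      rw [← add_div, Real.sqrt_div (by linarith)]
    rw [hsq] at hb
    calc ρ r * ∑ d ∈ (Icc 1 Nm).filter
          (fun d : ℕ => y / r < (d : ℝ) ∧ (d : ℝ) ≤ y / r + h / r), LamC d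
        ≤ ρ r * (E₀ * (h / r) + E₁ * (Real.sqrt (y + h) / Real.sqrt r)) :=
          mul_le_mul_of_nonneg_left hb (hρ0 r)
      _ = E₀ * h * (ρ r / r) + E₁ * Real.sqrt (y + h) * (ρ r / Real.sqrt r) := by ring
  have hρ1 : ∑ r ∈ Icc 1 Nm, ρ r / r ≤ Real.exp 112 := by
    refine le_trans (le_of_eq (sum_congr rfl fun r _ => ?_)) (sum_rho_div_le Nm)
    simp only [hρ]; rw [div_div]
  have hρ2 : ∑ r ∈ Icc 1 Nm, ρ r / Real.sqrt r ≤ Real.exp 112 := by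
    refine le_trans (le_of_eq (sum_congr rfl fun r _ => ?_)) (sum_rho_div_sqrt_le Nm)
    simp only [hρ]; rw [div_div]
  have hE₀0 : 0 ≤ E₀ := (Real.exp_pos _).le
  have hE₁0 : 0 ≤ E₁ := (Real.exp_pos _).le
  have hsq0 : 0 ≤ Real.sqrt (y + h) := Real.sqrt_nonneg _
  calc ∑ k ∈ T, ∑ x ∈ pairs.filter (fun x : ℕ × ℕ => x.1 * x.2 = k), wt x
      ≤ ∑ x ∈ pairs.filter
          (fun x : ℕ × ℕ => y < ((x.1 * x.2 : ℕ) : ℝ) ∧ ((x.1 * x.2 : ℕ) : ℝ) ≤ y + h), wt x := hstep1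
    _ = ∑ r ∈ Icc 1 Nm, ρ r * ∑ d ∈ (Icc 1 Nm).filter
          (fun d : ℕ => y / r < (d : ℝ) ∧ (d : ℝ) ≤ y / r + h / r), LamC d := hstep2
    _ ≤ ∑ r ∈ Icc 1 Nm, (E₀ * h * (ρ r / r) + E₁ * Real.sqrt (y + h) * (ρ r / Real.sqrt r)) :=
        sum_le_sum hstep3
    _ = E₀ * h * ∑ r ∈ Icc 1 Nm, ρ r / r +
          E₁ * Real.sqrt (y + h) * ∑ r ∈ Icc 1 Nm, ρ r / Real.sqrt r := by
        rw [sum_add_distrib, mul_sum, mul_sum]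
    _ ≤ E₀ * h * Real.exp 112 + E₁ * Real.sqrt (y + h) * Real.exp 112 := by
        gcongr
    _ ≤ Aw * (h + Real.sqrt (y + h)) := by
        rw [Aw]
        nlinarith [mul_nonneg hE₁0 hh, mul_nonneg hE₀0 hsq0, Real.exp_pos (112 : ℝ)]

/-! ### Part 3. The `G`-input: the truncated majorant `GS·𝟙_{n ≤ Nm}` -/

/-- `⌈PT⁻²⌉ ≤ 4P`, indeed `≤ P + 1 ≤ 2P`. [cite: Zhang2022LandauSiegel, §7 (7.2)] -/
theorem Nsupp_le_four_P (D : ℕ) : (Skeleton.Nsupp D : ℝ) ≤ 4 * Skeleton.bigP D := by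
  have hℓ : 0 ≤ Skeleton.ell D := Real.log_natCast_nonneg D
  have hP : 1 ≤ Skeleton.bigP D := Real.one_le_exp (pow_nonneg hℓ 9)
  have hT : 1 ≤ Skeleton.bigT D := Real.one_le_exp (Real.rpow_nonneg hℓ _)
  have hx0 : 0 ≤ Skeleton.bigP D / Skeleton.bigT D ^ 2 := by positivity
  have hx : Skeleton.bigP D / Skeleton.bigT D ^ 2 ≤ Skeleton.bigP D :=
    div_le_self (by linarith) (one_le_pow₀ hT)
  have hc : (Skeleton.Nsupp D : ℝ) < Skeleton.bigP D / Skeleton.bigT D ^ 2 + 1 := by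
    rw [Skeleton.Nsupp]; exact Nat.ceil_lt_add_one hx0
  linarith

/-- **The three engine means of the truncated majorant.** For `D ≥ ⌈exp(5|c′|π+3)⌉` and
`Nm ≤ 4P`, the function `G(n) = GS(n)·[n ≤ Nm]` satisfies, for EVERY `X`,
`Σ_{n≤X} G ≤ 2E_S·X`, `Σ_{n≤X} G/n ≤ 2E_S(1 + log X)`, `Σ_{n≤X} G/√n ≤ 2E_S√X`.
[cite: Zhang2022LandauSiegel, §7 p.33; §12 p.67] -/
theorem truncGS_means {c' : ℝ} {D : ℕ} (hD : ⌈Real.exp (5 * |c'| * π + 3)⌉₊ ≤ D) {Nm : ℕ}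
    (hNm : (Nm : ℝ) ≤ 4 * Skeleton.bigP D) (X : ℕ) :
    (∑ n ∈ Icc 1 X, (if n ≤ Nm then GS c' D n else 0) ≤ 2 * ES * X) ∧
      (∑ n ∈ Icc 1 X, (if n ≤ Nm then GS c' D n else 0) / n ≤ 2 * ES * (1 + Real.log X)) ∧
      (∑ n ∈ Icc 1 X, (if n ≤ Nm then GS c' D n else 0) / Real.sqrt n ≤
        2 * ES * Real.sqrt X) := by
  set X' := min X Nm with hX'
  have hX'P : (X' : ℝ) ≤ 4 * Skeleton.bigP D :=
    le_trans (by exact_mod_cast min_le_right X Nm) hNm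
  obtain ⟨h1, h2, h3⟩ := GS_means_ell hD hX'P (c' := c')
  have hfilt : (Icc 1 X).filter (fun n : ℕ => n ≤ Nm) = Icc 1 X' := by
    ext n; simp only [mem_filter, mem_Icc, hX', le_min_iff]; tauto
  have hES := ES_pos.le
  have hX'X : (X' : ℝ) ≤ X := by exact_mod_cast min_le_left X Nm
  have hlogX' : Real.log X' ≤ Real.log X := by
    rcases Nat.eq_zero_or_pos X' with h0 | hpos
    · rw [h0, Nat.cast_zero, Real.log_zero]; exact Real.log_natCast_nonneg X
    · exact Real.log_le_log (by exact_mod_cast hpos) hX'X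
  have hlog0 : 0 ≤ Real.log (X : ℝ) := Real.log_natCast_nonneg X
  refine ⟨?_, ?_, ?_⟩
  · rw [← sum_filter, hfilt]
    calc ∑ n ∈ Icc 1 X', GS c' D n ≤ ES * X' := h1
      _ ≤ 2 * ES * X := by nlinarith
  · have e : ∑ n ∈ Icc 1 X, (if n ≤ Nm then GS c' D n else 0) / (n : ℝ) =
        ∑ n ∈ Icc 1 X, (if n ≤ Nm then GS c' D n / n else 0) :=
      sum_congr rfl fun n _ => by split_ifs <;> simp
    rw [e, ← sum_filter, hfilt]
    calc ∑ n ∈ Icc 1 X', GS c' D n / n ≤ ES * (1 + Real.log X') := h2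
      _ ≤ 2 * ES * (1 + Real.log X) := by nlinarith
  · have e : ∑ n ∈ Icc 1 X, (if n ≤ Nm then GS c' D n else 0) / Real.sqrt n =
        ∑ n ∈ Icc 1 X, (if n ≤ Nm then GS c' D n / Real.sqrt n else 0) :=
      sum_congr rfl fun n _ => by split_ifs <;> simp
    rw [e, ← sum_filter, hfilt]
    calc ∑ n ∈ Icc 1 X', GS c' D n / Real.sqrt n ≤ 2 * ES * Real.sqrt X' := h3
      _ ≤ 2 * ES * Real.sqrt X := by gcongr


/-! ### Part 4. The sharp window bound for `S_j` -/

/-- The absolute constant `E_w = 2E_S·A'` of the window bound. [cite: Zhang2022LandauSiegel, §7 Prop. 7.1 p.33] -/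
def Ew : ℝ := 2 * ES * Aw

/-- `0 ≤ E_w`. [cite: Zhang2022LandauSiegel, §7 Prop. 7.1 p.33] -/
theorem Ew_nonneg : 0 ≤ Ew := by unfold Ew; have := ES_pos; have := Aw_nonneg; positivity

/-- **The sharp absolute-value bound for `S_j(𝐚₁,𝐚₂)` on window-supported sequences.** Let
`D ≥ ⌈exp(5|c′|π+3)⌉`, `1 ≤ Y, Y'`, `0 < δ, δ' ≤ 1`, and let `𝐚₁, 𝐚₂` satisfy
`‖a₁(n)‖ ≤ B₁·[Y < n ≤ Y(1+δ)]`, `‖a₂(n)‖ ≤ B₂·[Y' < n ≤ Y'(1+δ')]`. Then for every `j`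
`‖S_j(𝐚₁,𝐚₂)‖ ≤ B₁B₂·E_w·(2δ(δ'(1 + log 2Y') + 2) + 4δ(1 + log(2/δ)) + 16/√(δY))`.
For the `𝓛⁻¹⁰`-windows of §§11–12 (`δ, δ' ≍ 𝓛⁻¹⁰`, `Y ≍ P^{1/2}`) this is `B₁B₂·O(𝓛⁻¹⁰log 𝓛)
= B₁B₂·o(α)` — the absolute-value route to the window mean squares DOES close, with exactly
one logarithmic range (not three). [cite: Zhang2022LandauSiegel, §7 Prop. 7.1 p.33; §11 p.64; §12 p.67] -/
theorem norm_Sj_window_le {c' : ℝ} {D : ℕ} (hD : ⌈Real.exp (5 * |c'| * π + 3)⌉₊ ≤ D) (j : ℕ)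
    {a₁ a₂ : ℕ → ℂ} {B₁ B₂ Y Y' δ δ' : ℝ} (hB₁ : 0 ≤ B₁) (hB₂ : 0 ≤ B₂) (hY : 1 ≤ Y)
    (hY' : 1 ≤ Y') (hδ : 0 < δ) (hδ1 : δ ≤ 1) (hδ' : 0 < δ') (hδ'1 : δ' ≤ 1)
    (ha₁ : ∀ n : ℕ, ‖a₁ n‖ ≤ if Y < (n : ℝ) ∧ (n : ℝ) ≤ Y * (1 + δ) then B₁ else 0)
    (ha₂ : ∀ n : ℕ, ‖a₂ n‖ ≤ if Y' < (n : ℝ) ∧ (n : ℝ) ≤ Y' * (1 + δ') then B₂ else 0) :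
    ‖Skeleton.Sj c' D j a₁ a₂‖ ≤
      B₁ * B₂ * Ew * (2 * δ * (δ' * (1 + Real.log (2 * Y')) + 2) +
        4 * (δ * (1 + Real.log (2 / δ))) + 16 / Real.sqrt (δ * Y)) := by
  -- the support bound `N = Nm + 1`
  set N := Skeleton.Nsupp D with hN
  have hNle : (N : ℝ) ≤ 4 * Skeleton.bigP D := Nsupp_le_four_P D
  rcases Nat.eq_zero_or_pos N with hN0 | hNpos
  · -- empty sums
    have : Skeleton.Sj c' D j a₁ a₂ = 0 := by
      rw [Skeleton.Sj, ← hN, hN0]; simp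
    rw [this, norm_zero]
    have hΦ : 0 ≤ 2 * δ * (δ' * (1 + Real.log (2 * Y')) + 2) +
        4 * (δ * (1 + Real.log (2 / δ))) + 16 / Real.sqrt (δ * Y) := by
      have h1 : 0 ≤ Real.log (2 * Y') := Real.log_nonneg (by linarith)
      have h2 : 0 ≤ Real.log (2 / δ) := Real.log_nonneg (by rw [le_div_iff₀ hδ]; linarith)
      positivity
    have := Ew_nonneg
    positivity
  obtain ⟨Nm, hNm⟩ : ∃ Nm, N = Nm + 1 := ⟨N - 1, by omega⟩
  have hNmle : (Nm : ℝ) ≤ 4 * Skeleton.bigP D := le_trans (by rw [hNm]; push_cast; linarith) hNle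
  have hIco : Ico 1 N = Icc 1 Nm := by rw [hNm]; rfl
  -- the regrouped weight, the window sums and the truncated majorant
  set pairs := Icc 1 Nm ×ˢ Icc 1 Nm with hpairs
  set wt : ℕ × ℕ → ℝ := fun x =>
    LamC x.1 * (LamC x.2 * (2 : ℝ) ^ x.2.primeFactors.card / (Nat.totient x.2 : ℝ)) with hwt
  set cT : ℕ → ℝ := fun k => ∑ x ∈ pairs.filter (fun x : ℕ × ℕ => x.1 * x.2 = k), wt x with hcT
  set G : ℕ → ℝ := fun n => if n ≤ Nm then GS c' D n else 0 with hG
  set M : ℕ → ℝ := fun k => ∑ m ∈ Icc 1 Nm,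
    (if Y < (k : ℝ) * m ∧ (k : ℝ) * m ≤ Y * (1 + δ) then (1 : ℝ) / m else 0) with hM
  set Nn : ℕ → ℝ := fun k => ∑ n ∈ Icc 1 Nm,
    (if Y' < (k : ℝ) * n ∧ (k : ℝ) * n ≤ Y' * (1 + δ') then G n / n else 0) with hNn
  have hwt0 : ∀ x, 0 ≤ wt x := fun x =>
    mul_nonneg (LamC_nonneg _) (div_nonneg (mul_nonneg (LamC_nonneg _) (by positivity))
      (Nat.cast_nonneg _))
  have hcT0 : ∀ k, 0 ≤ cT k := fun k => sum_nonneg fun x _ => hwt0 x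
  have hG0 : ∀ n, 0 ≤ G n := fun n => by
    simp only [hG]; split_ifs <;> [exact GS_nonneg c' D n; exact le_rfl]
  have hM0 : ∀ k, 0 ≤ M k := fun k => sum_nonneg fun m _ => by
    split_ifs <;> [exact div_nonneg zero_le_one (Nat.cast_nonneg m); exact le_rfl]
  have hNn0 : ∀ k, 0 ≤ Nn k := fun k => sum_nonneg fun n _ => by
    split_ifs <;> [exact div_nonneg (hG0 n) (Nat.cast_nonneg n); exact le_rfl]
  -- Step 1: termwise bound and regrouping `k = dr`
  have hstep1 : ‖Skeleton.Sj c' D j a₁ a₂‖ ≤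
      B₁ * B₂ * ∑ x ∈ pairs, wt x / ((x.1 * x.2 : ℕ) : ℝ) * M (x.1 * x.2) * Nn (x.1 * x.2) := by
    rw [Skeleton.Sj, ← hN, hIco, mul_sum, hpairs, sum_product]
    refine (norm_sum_le _ _).trans (sum_le_sum fun d hd => ?_)
    refine (norm_sum_le _ _).trans (sum_le_sum fun r hr => ?_)
    have hd0 : d ≠ 0 := by have := (mem_Icc.mp hd).1; omega
    have hr0 : r ≠ 0 := by have := (mem_Icc.mp hr).1; omega
    have h := norm_Sj_term_window_le c' D hd0 hr0 j (Nm + 1) hB₁ hB₂ ha₁ ha₂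
    rw [show Ico 1 (Nm + 1) = Icc 1 Nm from rfl] at h
    refine h.trans (le_of_eq ?_)
    -- the `n`-sum with `GS` equals the one with the truncated `G` on `n ≤ Nm`
    have hNn_eq : (∑ n ∈ Icc 1 Nm, if Y' < ((d * r : ℕ) : ℝ) * n ∧ ((d * r : ℕ) : ℝ) * n ≤ Y' * (1 + δ')
        then GS c' D n / n else 0) = Nn (d * r) := by
      simp only [hNn, hG]
      refine sum_congr rfl fun n hn => ?_
      rw [if_pos (mem_Icc.mp hn).2]
    rw [hNn_eq]
    simp only [hM, hwt]
    ring
  -- Step 2: fibers of `x ↦ x.1 * x.2`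
  have hmaps : ∀ x ∈ pairs, x.1 * x.2 ∈ Icc 1 (Nm * Nm) := by
    intro x hx
    rw [hpairs, mem_product, mem_Icc, mem_Icc] at hx
    rw [mem_Icc]
    exact ⟨Nat.mul_pos hx.1.1 hx.2.1, Nat.mul_le_mul hx.1.2 hx.2.2⟩
  have hstep2 : ∑ x ∈ pairs, wt x / ((x.1 * x.2 : ℕ) : ℝ) * M (x.1 * x.2) * Nn (x.1 * x.2) =
      ∑ k ∈ Icc 1 (Nm * Nm), cT k / k * M k * Nn k := by
    rw [← sum_fiberwise_of_maps_to hmaps]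
    refine sum_congr rfl fun k _ => ?_
    rw [hcT]
    simp only []
    rw [sum_div, sum_mul, sum_mul]
    refine sum_congr rfl fun x hx => ?_
    rw [mem_filter] at hx
    rw [hx.2]
  -- Step 3: the engine
  have hG1 : ∀ X : ℕ, ∑ n ∈ Icc 1 X, G n ≤ 2 * ES * X := fun X => (truncGS_means hD hNmle X).1
  have hG2 : ∀ X : ℕ, ∑ n ∈ Icc 1 X, G n / n ≤ 2 * ES * (1 + Real.log X) := fun X =>
    (truncGS_means hD hNmle X).2.1
  have hG3 : ∀ X : ℕ, ∑ n ∈ Icc 1 X, G n / Real.sqrt n ≤ 2 * ES * Real.sqrt X := fun X =>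
    (truncGS_means hD hNmle X).2.2
  have hc1 : ∀ (K : ℕ) (y h : ℝ), 0 ≤ y → 0 ≤ h →
      ∑ k ∈ (Icc 1 K).filter (fun k : ℕ => y < (k : ℝ) ∧ (k : ℝ) ≤ y + h), cT k ≤
        Aw * (h + Real.sqrt (y + h)) := fun K y h hy hh => sum_cTilde_short_le Nm K hy hh
  have hengine := window_triple_sum_le hcT0 hG0 (by have := ES_pos; positivity) Aw_nonneg
    hG1 hG2 hG3 hc1 hY hY' hδ hδ1 hδ' hδ'1 (Nm * Nm) Nm
  -- assemble
  calc ‖Skeleton.Sj c' D j a₁ a₂‖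
      ≤ B₁ * B₂ * ∑ x ∈ pairs, wt x / ((x.1 * x.2 : ℕ) : ℝ) * M (x.1 * x.2) * Nn (x.1 * x.2) :=
        hstep1
    _ = B₁ * B₂ * ∑ k ∈ Icc 1 (Nm * Nm), cT k / k * M k * Nn k := by rw [hstep2]
    _ ≤ B₁ * B₂ * (2 * ES * Aw * (2 * δ * (δ' * (1 + Real.log (2 * Y')) + 2) +
          4 * (δ * (1 + Real.log (2 / δ))) + 16 / Real.sqrt (δ * Y))) :=
        mul_le_mul_of_nonneg_left hengine (mul_nonneg hB₁ hB₂)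
    _ = _ := by rw [Ew]; ring

end Literature.NumberTheory.LFunctions.Zhang2022.XiZeroMajorant
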